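import Literature.Topology.FourManifolds.HandleAttachingMaps
import Literature.Topology.FourManifolds.Handles
import Literature.Topology.FourManifolds.Gluing
import Literature.Topology.FourManifolds.SmoothOrientation
import Literature.Topology.FourManifolds.TorusCoordinates
import Literature.Geometry.Symplectic.PlanarContactBoundary
import HarnessLib

/-!
# The achiral Lefschetz handlebody `X(P; w)` over an arbitrary page, and the closed model
# manifold of an achiral word

Topic `Literature/Topology/FourManifolds`.  Definitions only (relational predicates in the style of
`IsBoundaryGluing` / `IsDouble` / `HandleAttachingMap.IsMultiAttachment`); NOTHING is asserted.

**The printed construction** (Kas 1980; Harer 1979; Gompf–Stipsicz 1999, §8.2; Etnyre–Fuller 2006,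
§2, p. 4: *"The manifold `X` is obtained from `Σ × D²` by attaching 2-handles along the `γ_{pᵢ}`'s
with framing one less than the framing induced by `Σ` … the 2-handles attached to the vanishing
cycle of a negative critical point will have framing one more than the framing induced by `Σ` and
the contribution to the monodromy will be a left handed Dehn twist"*).  Let `P` be a compact
oriented surface with nonempty boundary and `w = (c₀^{ε₀}, …, c_{n-1}^{ε_{n-1}})` a word of simple
closed curves `cᵢ ⊂ int P` with signs `εᵢ = ±1`.  The **achiral Lefschetz handlebody** `X(P; w)` is
`P × D²` (corners rounded: the compact 4-dimensional 1-handlebody `♮ᵏ S¹ × B³`,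
`k = 1 - χ(P) = rk H₁(P)`, Etnyre–Fuller p. 4) with one 2-handle per letter, attached along `cᵢ`
pushed into the page `P × {θᵢ}` of `∂(P × D²) ⊃ P × S¹` (distinct pages, in the cyclic order of
the word) with framing `pf - εᵢ`, `pf` the page (= product) framing.  It is the total space of the
achiral Lefschetz fibration over `D²` with regular fibre `P` and vanishing cycles `cᵢ`, positive for
`εᵢ = +1`.  When `w` is a factorisation of the identity of `Mod(P, ∂P)` the boundary open book of
`X(P; w)` is `(P, id) = ∂(P × D²)` and the **closed model** `X̂(P; w) = X(P; w) ∪ (P × D²)` is the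
achiral Lefschetz fibration over `S²` closed off over the second hemisphere; by Laudenbach–Poénaru
(tree fact `exists_diffeomorph_comp_incl_eq`) the cap `P × D² ≅ ♮ᵏ S¹ × B³` may be glued by ANY
boundary diffeomorphism, i.e. `X̂` is `X(P; w)` plus `k` 3-handles and a 4-handle.

## The Lean rendering

The existing `LefschetzBase.IsLefschetzHandlebody g l X` (`LefschetzHandlebody.lean`) covers the
page `F_{g,1}` through a CONCRETE base in `ℂ²` and records vanishing cycles by homology shadows
only.  Here the page is an ARBITRARY compact oriented smooth surface with boundary `P` (model
`𝓡∂ 2`, orientation `o : SmoothOrientation (𝓡∂ 2) P`) and the cycles are honest curves, as the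
Hurwitz calculus of `Mod(P, ∂P)` requires:

* `SignedCycle P` — a letter `c^ε`: an annulus chart `annulus : 𝕊¹ × ℝ → P` (the curve is its core
  `annulus (·, 0)`, the chart fixes a tubular neighbourhood and, being asked `o`-positive below, the
  side towards which framings are counted) and a sign `pos : Bool` (`true` = `ε = +1`).
  `SignedCycle.bar` flips the sign; `AchiralLefschetz.wordInv w = (w.map bar).reverse` is the
  inverse word `w̄ = (c̄_{n-1}, …, c̄₀)` (the helpers `wordInv`, `pageAngle`, `twistCoeff`,
  `attachModel` live in the sub-namespace `AchiralLefschetz`).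
* `IsPageSystem ob J` — for an open book `ob : OpenBook M` (`Geometry/Symplectic/
  PlanarContactBoundary.lean`) of a 3-manifold `M` and `J : P × ℝ → M`: on `int P × ℝ`, `J` is
  smooth, `1`-periodic in the angle, maps `int P × {θ}` injectively and immersively into the page
  over `circlePt θ = e^{2πiθ}`, and every point off the binding is some `J (q, θ)`.  So
  `M ∖ B ≅ int P × S¹` over `S¹` (the open book is `(P, id)`, trivialised by `J`) and `J (q, θ)` is
  "the point `q` of the page of angle `θ`"; on `∂P × ℝ` the values of `J` are unconstrained.
* `boundaryTorusPt x z` (`x ∈ 𝕊¹`, `‖z‖ < 1`) — the point `(√(1-|z|²)·x, z)` of Kosinski's tube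
  `T ⊂ D⁴ ⊂ ℂ²` on the sphere `∂D⁴`: the open solid torus `T ∩ ∂D⁴ = S³ ∖ {z₁ = 0}` along which a
  2-handle is attached, parametrised by its core angle `x = z₁/|z₁|` and normal coordinate `z = z₂`.
* `attachModel J c θ₀ δ x z = J (c.annulus (x, δ Re ζ), θ₀ + δ Im ζ)` with the TWISTED
  normal coordinate `ζ = x̄ z` for a positive letter and `ζ = x z` for a negative one
  (`twistCoeff`): the prescribed value of the attaching map on `boundaryTorusPt x z`.  The handle
  framing `dh̄(∂/∂z₂)` is the direction `ζ ∈ ℝ₊ x^{∓1}`, which winds `∓1` times in the oriented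
  normal frame `(∂ₛ, ∂_θ)` of the knot `x ↦ J (c(x), θ₀)` as `x` goes once around: framing
  `pf - ε` ("one less" for positive, "one more" for negative letters), `∂ₛ` being the page framing
  and `∂_θ` the isotopic product framing.
* `pageAngle n i = -(i + ½)/n` — the angle of the `i`-th of `n` pages: `e^{2πiθᵢ}` is
  `LefschetzBase.pageDir n i` of `LefschetzBasePages.lean`, pages CLOCKWISE in the letter index, all
  in the fundamental domain `(-1, 0)` (so distinct letters get distinct pages,
  `circlePt_pageAngle_injective`); the convention of Akbulut–Ozbagci 2001, §2.1–2.3 as audited there.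
* `IsLefschetzLinkOver o w b ob J δ h` — the Lefschetz link of the word `w` in the boundary
  `b : BoundaryData (𝓡∂ 4) B (𝓡 3)` of a 4-manifold `B`: page system `J`; every annulus chart a
  smooth embedding of `𝕊¹ × ℝ` into `int P`, ORIENTATION PRESERVING for `o` (read through the
  `1`-periodic lift `(t, s) ↦ annulus (e^{2πit}, s)` of `𝔼 2`, standard orientation); a width
  `δ > 0`; and attaching maps `h i : HandleAttachingMap 3 2 B` which ON THE BOUNDARY TORUS ARE the
  model: `h i (boundaryTorusPt x z) = b.incl (attachModel J wᵢ (pageAngle n i) δ x z)` — by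
  `exists_boundaryTorusPt_eq` this prescribes `h i` on all of `T ∩ ∂D⁴`.
* `IsLefschetzHandlebodyOver o w W` — **`W` is `X(P; w)`**: `W` is the simultaneous attachment
  (`HandleAttachingMap.IsMultiAttachment`) of such a link to a compact connected orientable
  4-dimensional 1-handlebody `B` (`IsHandlebodyOfIndexLE 3 1 B`) whose boundary carries an open
  book with page system by `P`.
* `IsAchiralLefschetzModel o w X` — **`X` is the closed model `X̂(P; w)`**: `X = W ∪_Ψ V`
  (`IsBoundaryGluing`) for an achiral Lefschetz handlebody `W` of `w`, a compact connected
  orientable 1-handlebody `V` and SOME boundary diffeomorphism `Ψ`.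

## Faithfulness (why these clauses pin down the diffeomorphism types; for the auditor)

(1) BASE.  `∂B ∖ binding ≅ int P × S¹` fibrewise (`IsPageSystem`: a smooth bijective immersion
between 3-manifolds is a diffeomorphism), and the tube normal form of `OpenBook` makes the closed
pages compact surfaces with interior `int P` and boundary the binding, so `∂B` is the open book
`(P, id) ≅ #ᵏ S¹ × S²`; `B` being a compact connected orientable 1-handlebody with this boundary,
`B ≅ ♮ᵏ S¹ × B³` (Kosinski VI (11.4)(c), tree `OneHandlebodyClassification.lean`) and EVERY
diffeomorphism `∂B ≅ ∂(P × D²)` extends (Laudenbach–Poénaru 1972): after a page-wise isotopy of `J`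
supported near `∂P` (untwisting `J` along the binding, away from the cycles) one may take it to carry
`J` to the standard `P × S¹ ⊂ ∂(P × D²)`.  (2) HANDLES.  The prescription on the boundary torus
fixes the attaching circle `x ↦ J (cᵢ(x), θᵢ)` (`IsLefschetzLinkOver.attachingCircle_eq`) and the
framing `pf - εᵢ`; the interior of Kosinski's `h̄` is a collar choice, immaterial up to diffeomorphism
(uniqueness of tubular neighbourhoods; `IsOpenGluing.nonempty_diffeomorph`).  Since `h i` is a smooth
embedding agreeing with `b.incl ∘ J ∘ (annulus-model)` on the torus, the annulus chart is automatically
a smooth embedding near its core there, so the orientation clause is the honest one.  Isotoping each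
`cᵢ` inside its own page slab does not change the handlebody, so only the isotopy classes of the `cᵢ`
in `P`, the signs and the cyclic order matter: `W ≅ X(P; w)`.  (3) CAP.  `V ≅ ♮ᵐ S¹ × B³` with
`∂V ≅ ∂W` forces `m` (`H₁`), and the glued manifold does not depend on `Ψ` (Laudenbach–Poénaru; tree
facts `exists_diffeomorph_comp_incl_eq`, `nonempty_diffeomorph_of_isBoundaryGluing_twoHandlebody`).
For a factorisation `w` of the identity `∂W ≅ #ᵏ S¹ × S²` and `X ≅ X̂(P; w)`; for other words the
predicate holds of `W ∪ V` whenever `∂W` happens to bound a 1-handlebody `V` (e.g. `P` an annulus,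
`w = (core⁺)`: `W = B⁴`, `X = S⁴`) — the consumers quantify over factorisations of the identity.
(4) ORIENTATIONS.  No orientation of `B`, `W`, `X` is chosen: chirality is bookkept relative to `J`.
Orient `B` so that the boundary orientation (outward normal first) of `J(int P × S¹)` is
`o × (∂_θ)`, i.e. `B = P × D²` with the product of `o` and the complex orientation of `D²`; for the
extension of this orientation over `W`, a letter with `pos = true` is a 2-handle with framing `pf - 1`,
i.e. a POSITIVE Lefschetz critical point with monodromy the RIGHT-handed Dehn twist about its cycle,
and `pos = false` a negative one (Etnyre–Fuller 2006, §2; Gompf–Stipsicz 1999, §8.2).  The pair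
(orientation of the page, signs) carries the chirality: replacing `o` by `-o` and each chart by the
`-o`-positive chart `(x, s) ↦ annulus (x, -s)` (same cycles) turns the model offset `ζ` into `-ζ̄`,
i.e. describes in `∂B` the framed link of the SIGN-FLIPPED word for `o` (framings `pf + εᵢ`) — a
different manifold in general; a framing being a parallel curve, no orientation of `B`, `W` or `X`
is needed to specify it.  With pages clockwise in the index and the functional convention of
Akbulut–Ozbagci 2001, §2.3 (as audited in `LefschetzBasePages.lean` (b)), the monodromy of the
boundary open book of `W`, read counter-clockwise, is `t_{c₀}^{ε₀} ∘ t_{c₁}^{ε₁} ∘ ⋯ ∘ t_{c_{n-1}}^{ε_{n-1}}`.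
A global error in (4) would exchange every statement over this vocabulary with the one for the
reversed or sign-flipped word; (4) is the one place to audit.

## Intended named facts over this vocabulary (NOT stated here; they need `Mod(P, ∂P)` words —
definition request `defn-DehnTwistFactorisation` — or PALF vocabulary)

Hurwitz moves `(cᵢ, cᵢ₊₁) ↦ (t_{cᵢ}^{εᵢ}(cᵢ₊₁), cᵢ)`, global conjugation and Hopf stabilisation
preserve `X(P; w)` (Gompf–Stipsicz §8.2; Etnyre–Fuller §2, p. 5: *"stabilizing results in … the
same 4-manifold"*; Baykur 2006, §5); a compact Stein domain with a PALF is `X(P; a)` for its positive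
word (Akbulut–Ozbagci 2001; Loi–Piergallini 2001); `X(P; c c̄)` closed off is the double `D(X(P; c))`;
inserting `(u, ū)` is `# S² × S²` or `# S² ×~ S²` (Gompf–Stipsicz §8.4).

## References

* A. Kas, *On the handlebody decomposition associated to a Lefschetz fibration*, Pacific J. Math.
  89 (1980), 89–104. [Kas1980]
* J. B. Etnyre, T. Fuller, *Realizing 4-manifolds as achiral Lefschetz fibrations*, IMRN 2006,
  §2 (pp. 4–5 of arXiv:math/0510008). [EtnyreFuller2006]
* R. E. Gompf, A. I. Stipsicz, *4-Manifolds and Kirby Calculus*, GSM 20 (1999), §4.4, §8.2, §8.4.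
  [GompfStipsiczGSM1999]
* S. Akbulut, B. Ozbagci, *Lefschetz fibrations on compact Stein surfaces*, Geom. Topol. 5 (2001),
  §2. [AkbulutOzbagci2001]
* R. İ. Baykur, *Kähler decomposition of 4-manifolds*, AGT 6 (2006), §3–§5. [Baykur2006]
* F. Laudenbach, V. Poénaru, *A note on 4-dimensional handlebodies*, BSMF 100 (1972).
  [LaudenbachPoenaruBSMF1972]
* A. A. Kosinski, *Differential Manifolds* (1993), VI §6 (attaching maps). [Kosinski1993]
-/

noncomputable section

open scoped Manifold ContDiff ComplexConjugate
open Set Function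

namespace Literature.Topology.FourManifolds

universe u v

/-- Local notation: `𝔼 n` is the model Euclidean space `EuclideanSpace ℝ (Fin n)`. -/
local notation "𝔼 " n:arg => EuclideanSpace ℝ (Fin n)

/-- Local notation: `𝕊 n` is the unit sphere in `EuclideanSpace ℝ (Fin (n + 1))`. -/
local notation "𝕊 " n:arg => (Metric.sphere (0 : EuclideanSpace ℝ (Fin (n + 1))) 1)

/-- Local notation: `𝔻 n` is the closed unit ball in `EuclideanSpace ℝ (Fin n)`. -/
local notation "𝔻 " n:arg => (Metric.closedBall (0 : EuclideanSpace ℝ (Fin n)) 1)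

/-! ### Letters: signed cycles and achiral words -/

/-- **A letter `c^ε` of an achiral word over the surface `P`**: an annulus chart
`annulus : 𝕊¹ × ℝ → P` around the simple closed curve `c = annulus (·, 0)` (its core; the chart
also fixes the normal direction `s ↦ annulus (x, s)` along which framings are counted, and is
required to be orientation preserving where it is used, `IsLefschetzLinkOver.orient`) and a sign
`pos` (`true` = `ε = +1`: a positive Lefschetz 2-handle, framing `pf - 1`, right-handed twist;
`false` = `ε = -1`: framing `pf + 1`, left-handed twist).  Etnyre–Fuller 2006, §2; Gompf–Stipsicz
1999, §8.2 / §8.4.  No property is bundled (a plain datum, so that any curve calculus maps into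
it). [cite: EtnyreFuller2006, §2] -/
structure SignedCycle (P : Type v) where
  /-- the annulus chart; the vanishing cycle is its core `annulus (·, 0)` -/
  annulus : (𝕊 1) × ℝ → P
  /-- the chirality: `true` = positive letter -/
  pos : Bool

namespace SignedCycle

variable {P : Type v}

/-- The vanishing cycle itself: the core `x ↦ annulus (x, 0)` of the annulus chart. [folklore] -/
def curve (c : SignedCycle P) (x : 𝕊 1) : P := c.annulus (x, 0)

/-- The letter with the opposite sign, `c^ε ↦ c^{-ε}` (same curve, same chart). [folklore] -/
def bar (c : SignedCycle P) : SignedCycle P := ⟨c.annulus, !c.pos⟩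

/-- `bar` keeps the annulus chart. [folklore] -/
@[simp] theorem bar_annulus (c : SignedCycle P) : c.bar.annulus = c.annulus := rfl

/-- `bar` flips the sign. [folklore] -/
@[simp] theorem bar_pos (c : SignedCycle P) : c.bar.pos = !c.pos := rfl

/-- `bar` keeps the curve. [folklore] -/
@[simp] theorem bar_curve (c : SignedCycle P) : c.bar.curve = c.curve := rfl

/-- `bar` is an involution. [folklore] -/
@[simp] theorem bar_bar (c : SignedCycle P) : c.bar.bar = c := by
  cases c; simp [bar]

end SignedCycle

namespace AchiralLefschetz

/-- **The inverse word** `w̄ = (c̄_{n-1}, …, c̄₀)` of `w = (c₀, …, c_{n-1})`: reverse the order and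
flip every sign — the word of the upside-down (orientation-reversed) handlebody, so that e.g. the
double `X(P; c) ∪ X̄(P; c)` is closed off from the word `c ++ wordInv c`, and a twisted double of two
positive handlebodies `a`, `b` over one open book from `a ++ wordInv b` (Gompf–Stipsicz 1999, §8.4;
Baykur 2006, §5). [cite: Baykur2006, §5] -/
def wordInv {P : Type v} (w : List (SignedCycle P)) : List (SignedCycle P) :=
  (w.map SignedCycle.bar).reverse

/-- The inverse word has the same length. [folklore] -/
@[simp] theorem length_wordInv {P : Type v} (w : List (SignedCycle P)) :
    (wordInv w).length = w.length := by
  simp [wordInv]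

/-- `wordInv` is an involution. [folklore] -/
@[simp] theorem wordInv_wordInv {P : Type v} (w : List (SignedCycle P)) :
    wordInv (wordInv w) = w := by
  simp [wordInv, List.map_reverse, Function.comp_def]

/-- `wordInv` is anti-multiplicative: `(a ++ b)‾ = b̄ ++ ā`. [folklore] -/
theorem wordInv_append {P : Type v} (a b : List (SignedCycle P)) :
    wordInv (a ++ b) = wordInv b ++ wordInv a := by
  simp [wordInv]

end AchiralLefschetz

/-! ### Page systems: the open book `(P, id)` trivialised by `J : P × ℝ → M` -/

section PageSystem

variable {P : Type v} [TopologicalSpace P] [ChartedSpace (EuclideanHalfSpace 2) P]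
  {M : Type u} [TopologicalSpace M] [ChartedSpace (𝔼 3) M] [IsManifold (𝓡 3) ∞ M]

/-- **Page system.**  `IsPageSystem ob J`: the map `J : P × ℝ → M`, `(q, θ) ↦` "the point `q` of
the page of angle `θ`", trivialises the open book `ob` of the 3-manifold `M` with page the interior
of the compact surface with boundary `P`: on `int P × ℝ`, `J` is smooth and `1`-periodic in `θ`;
for `q ∈ int P`, `J (q, θ)` lies on the page over `circlePt θ = e^{2πiθ}`; on `int P × {θ}` it is
injective with injective differential; and every point off the binding is some `J (q, θ)`,
`q ∈ int P`.  Hence `M ∖ B ≅ int P × S¹` over `S¹`: `(M, ob)` is the open book with page `P` and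
monodromy the identity, `∂(P × D²) ⊃ P × S¹` (Etnyre–Fuller 2006, §2: *"`(∂Σ) × D²` is a
neighborhood of `B` … `(∂X) ∖ B` is the `Σ`-bundle over `S¹`"*; the closed pages are then compact
surfaces with interior `int P` bounded by the binding, by the normal form of `OpenBook` near `B`).
Values of `J` on `∂P × ℝ` are junk (never used). [cite: EtnyreFuller2006, §2] -/
structure IsPageSystem (ob : Literature.Geometry.Symplectic.OpenBook M) (J : P × ℝ → M) : Prop where
  /-- `J` is smooth on `int P × ℝ` (an open subset of `P × ℝ`) -/
  contMDiffOn : ContMDiffOn ((𝓡∂ 2).prod 𝓘(ℝ, ℝ)) (𝓡 3) ∞ J ((𝓡∂ 2).interior P ×ˢ univ)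
  /-- `J` is `1`-periodic in the angle -/
  periodic : ∀ q ∈ (𝓡∂ 2).interior P, ∀ θ : ℝ, J (q, θ + 1) = J (q, θ)
  /-- interior points go to the page of the prescribed angle -/
  mem_page : ∀ q ∈ (𝓡∂ 2).interior P, ∀ θ : ℝ, J (q, θ) ∈ ob.page (circlePt θ)
  /-- `J (·, θ)` is injective on the interior -/
  injOn : ∀ θ : ℝ, InjOn (fun q => J (q, θ)) ((𝓡∂ 2).interior P)
  /-- `J` is an immersion at interior points -/
  mfderiv_injective : ∀ q ∈ (𝓡∂ 2).interior P, ∀ θ : ℝ,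
    Injective (mfderiv ((𝓡∂ 2).prod 𝓘(ℝ, ℝ)) (𝓡 3) J (q, θ))
  /-- every point off the binding lies on a parametrised page -/
  exists_eq : ∀ y, y ∉ ob.binding → ∃ q ∈ (𝓡∂ 2).interior P, ∃ θ : ℝ, J (q, θ) = y

namespace IsPageSystem

variable {ob : Literature.Geometry.Symplectic.OpenBook M} {J : P × ℝ → M}

/-- Parametrised page points are off the binding. [folklore] -/
theorem apply_notMem_binding (hJ : IsPageSystem ob J) {q : P} (hq : q ∈ (𝓡∂ 2).interior P)
    (θ : ℝ) : J (q, θ) ∉ ob.binding :=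
  (hJ.mem_page q hq θ).1

/-- The open-book fibration reads the angle: `π (J (q, θ)) = e^{2πiθ}`. [folklore] -/
theorem proj_apply (hJ : IsPageSystem ob J) {q : P} (hq : q ∈ (𝓡∂ 2).interior P) (θ : ℝ) :
    ob.proj (J (q, θ)) = circlePt θ :=
  (hJ.mem_page q hq θ).2

/-- Periodicity under all natural-number shifts of the angle. [folklore] -/
theorem apply_add_nat (hJ : IsPageSystem ob J) {q : P} (hq : q ∈ (𝓡∂ 2).interior P) (θ : ℝ)
    (n : ℕ) : J (q, θ + n) = J (q, θ) := by
  induction n with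
  | zero => simp
  | succ n ih => rw [Nat.cast_succ, ← add_assoc, hJ.periodic q hq, ih]

/-- `J` is smooth at every point of `int P × ℝ` (that set is open, `P` being `C¹`). [folklore] -/
theorem contMDiffAt [IsManifold (𝓡∂ 2) 1 P] (hJ : IsPageSystem ob J) {q : P}
    (hq : q ∈ (𝓡∂ 2).interior P) (θ : ℝ) :
    ContMDiffAt ((𝓡∂ 2).prod 𝓘(ℝ, ℝ)) (𝓡 3) ∞ J (q, θ) := by
  have hopen : IsOpen ((𝓡∂ 2).interior P) :=
    ModelWithCorners.isOpen_interior (I := 𝓡∂ 2) (M := P) (n := 1) one_ne_zero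
  exact (hJ.contMDiffOn (q, θ) ⟨hq, mem_univ _⟩).contMDiffAt
    ((hopen.prod isOpen_univ).mem_nhds ⟨hq, mem_univ _⟩)

/-- The complement of the binding is exactly the union of the parametrised pages. [folklore] -/
theorem compl_binding_eq (hJ : IsPageSystem ob J) :
    ob.bindingᶜ = J '' (𝓡∂ 2).interior P ×ˢ (univ : Set ℝ) := by
  ext y
  constructor
  · intro hy
    obtain ⟨q, hq, θ, rfl⟩ := hJ.exists_eq y hy
    exact ⟨(q, θ), ⟨hq, mem_univ _⟩, rfl⟩
  · rintro ⟨⟨q, θ⟩, ⟨hq, -⟩, rfl⟩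
    exact hJ.apply_notMem_binding hq θ

end IsPageSystem

end PageSystem

/-! ### The boundary torus of Kosinski's tube and the twisted attaching model -/

/-- The vector `(√(1 - |z|²)·x, z) ∈ ℝ⁴ = ℂ²` (`z₁ = √(1-|z|²) x`, `z₂ = z`): for `‖z‖ ≤ 1` a point
of the unit sphere `∂D⁴`, off the circle `{z₁ = 0}` when `‖z‖ < 1`. [cite: Kosinski1993, VI §6] -/
def boundaryTorusVec (x : 𝕊 1) (z : ℂ) : 𝔼 4 :=
  WithLp.toLp 2 ![Real.sqrt (1 - ‖z‖ ^ 2) * (x : 𝔼 2) 0, Real.sqrt (1 - ‖z‖ ^ 2) * (x : 𝔼 2) 1,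
    z.re, z.im]

/-- `|x_λ|²` of the torus vector is `1 - |z|²` (for `‖z‖ ≤ 1`). [folklore] -/
theorem lamSq_boundaryTorusVec (x : 𝕊 1) {z : ℂ} (hz : ‖z‖ ≤ 1) :
    lamSq 2 (boundaryTorusVec x z) = 1 - ‖z‖ ^ 2 := by
  have h1 : 0 ≤ 1 - ‖z‖ ^ 2 := by nlinarith [norm_nonneg z]
  -- on the circle `x₀² + x₁² = 1` (cf. `BlowDownFlat.sphere_sq`, not imported: import closure)
  have hx : (x : 𝔼 2) 0 ^ 2 + (x : 𝔼 2) 1 ^ 2 = 1 := by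
    have h : ‖(x : 𝔼 2)‖ ^ 2 = (x : 𝔼 2) 0 ^ 2 + (x : 𝔼 2) 1 ^ 2 := by
      rw [EuclideanSpace.norm_sq_eq, Fin.sum_univ_two, Real.norm_eq_abs, Real.norm_eq_abs, sq_abs,
        sq_abs]
    rw [← h, norm_eq_of_mem_sphere, one_pow]
  rw [lamSq_two_fin_four]
  change (Real.sqrt (1 - ‖z‖ ^ 2) * (x : 𝔼 2) 0) ^ 2 +
    (Real.sqrt (1 - ‖z‖ ^ 2) * (x : 𝔼 2) 1) ^ 2 = 1 - ‖z‖ ^ 2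
  rw [mul_pow, mul_pow, Real.sq_sqrt h1, ← mul_add, hx, mul_one]

/-- `|x_μ|²` of the torus vector is `|z|²`. [folklore] -/
theorem muSq_boundaryTorusVec (x : 𝕊 1) (z : ℂ) : muSq 2 (boundaryTorusVec x z) = ‖z‖ ^ 2 := by
  rw [muSq_two_fin_four, Complex.sq_norm, Complex.normSq_apply]
  change z.re ^ 2 + z.im ^ 2 = z.re * z.re + z.im * z.im
  ring

/-- The torus vector lies on the unit sphere `∂D⁴` (for `‖z‖ ≤ 1`). [folklore] -/
theorem norm_boundaryTorusVec (x : 𝕊 1) {z : ℂ} (hz : ‖z‖ ≤ 1) : ‖boundaryTorusVec x z‖ = 1 := by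
  have h := lamSq_add_muSq 2 (boundaryTorusVec x z)
  rw [lamSq_boundaryTorusVec x hz, muSq_boundaryTorusVec] at h
  have h' : ‖boundaryTorusVec x z‖ ^ 2 = 1 := by linarith
  nlinarith [norm_nonneg (boundaryTorusVec x z)]

/-- **The point `(√(1 - |z|²)·x, z)` of the boundary solid torus `T ∩ ∂D⁴ = S³ ∖ {z₁ = 0}` of
Kosinski's tube** (`handleTube 3 2`), parametrised by the core angle `x = z₁/|z₁| ∈ 𝕊¹` and the
normal complex coordinate `z = z₂`, `‖z‖ < 1`; `z = 0` is the attaching circle (`coreTubePt`).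
[cite: Kosinski1993, VI §6] -/
def boundaryTorusPt (x : 𝕊 1) (z : ℂ) (hz : ‖z‖ < 1) : ↥(handleTube 3 2) :=
  ⟨⟨boundaryTorusVec x z, mem_closedBall_zero_iff.2 (norm_boundaryTorusVec x hz.le).le⟩, by
    rw [mem_handleTube]
    change lamSq 2 (boundaryTorusVec x z) ≠ 0
    rw [lamSq_boundaryTorusVec x hz.le]
    nlinarith [norm_nonneg z]⟩

/-- The underlying vector of `boundaryTorusPt x z`. [folklore] -/
@[simp] theorem coe_coe_boundaryTorusPt (x : 𝕊 1) (z : ℂ) (hz : ‖z‖ < 1) :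
    (((boundaryTorusPt x z hz : ↥(handleTube 3 2)) : 𝔻 4) : 𝔼 4) = boundaryTorusVec x z := rfl

/-- The boundary torus lies on the sphere `∂D⁴`. [folklore] -/
theorem norm_boundaryTorusPt (x : 𝕊 1) (z : ℂ) (hz : ‖z‖ < 1) :
    ‖(((boundaryTorusPt x z hz : ↥(handleTube 3 2)) : 𝔻 4) : 𝔼 4)‖ = 1 :=
  norm_boundaryTorusVec x hz.le

/-- At `z = 0` the torus point is the point of the attaching circle over `x`. [folklore] -/
@[simp] theorem boundaryTorusPt_zero (x : 𝕊 1) :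
    boundaryTorusPt x 0 (by simp) = coreTubePt x := by
  apply Subtype.ext; apply Subtype.ext
  rw [coe_coe_boundaryTorusPt, coe_coe_coreTubePt]
  ext i
  fin_cases i <;> simp [boundaryTorusVec, corePt]

/-- **The boundary torus is the whole boundary part `T ∩ ∂D⁴` of Kosinski's tube**: every point
`y ∈ T` with `‖y‖ = 1` is `(√(1 - |z|²)·x, z)` for `x = z₁/|z₁|` and `z = z₂` (`|z₂|² = 1 - |z₁|² < 1`
since `z₁ ≠ 0` on `T`).  So a condition imposed at all `boundaryTorusPt x z` constrains an
attaching map on all of `T ∩ ∂D⁴`. [folklore] -/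
theorem exists_boundaryTorusPt_eq {y : ↥(handleTube 3 2)} (hy : ‖((y : 𝔻 4) : 𝔼 4)‖ = 1) :
    ∃ (x : 𝕊 1) (z : ℂ) (hz : ‖z‖ < 1), boundaryTorusPt x z hz = y := by
  set u : 𝔼 4 := ((y : 𝔻 4) : 𝔼 4) with hu
  have hl0 : lamSq 2 u ≠ 0 := y.2
  have hlpos : 0 < lamSq 2 u := lt_of_le_of_ne (lamSq_nonneg 2 u) (Ne.symm hl0)
  have hsum : lamSq 2 u + muSq 2 u = 1 := by rw [lamSq_add_muSq, hy, one_pow]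
  let z : ℂ := ⟨u 2, u 3⟩
  have hz2 : ‖z‖ ^ 2 = muSq 2 u := by
    rw [muSq_two_fin_four, Complex.sq_norm, Complex.normSq_apply]
    change u 2 * u 2 + u 3 * u 3 = u 2 ^ 2 + u 3 ^ 2
    ring
  have hz1 : 1 - ‖z‖ ^ 2 = lamSq 2 u := by linarith
  have hzlt : ‖z‖ < 1 := by
    have : ‖z‖ ^ 2 < 1 := by linarith
    nlinarith [norm_nonneg z]
  set r : ℝ := Real.sqrt (lamSq 2 u) with hr
  have hrpos : 0 < r := Real.sqrt_pos.2 hlpos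
  have hr2 : r ^ 2 = u 0 ^ 2 + u 1 ^ 2 := by rw [hr, Real.sq_sqrt hlpos.le, lamSq_two_fin_four]
  let v : 𝔼 2 := WithLp.toLp 2 ![u 0 / r, u 1 / r]
  have hv : ‖v‖ = 1 := by
    have h2 : ‖v‖ ^ 2 = (u 0 / r) ^ 2 + (u 1 / r) ^ 2 := by
      rw [EuclideanSpace.norm_sq_eq, Fin.sum_univ_two, Real.norm_eq_abs, Real.norm_eq_abs, sq_abs,
        sq_abs]
      rfl
    have h3 : ‖v‖ ^ 2 = 1 := by
      rw [h2, div_pow, div_pow, ← add_div, ← hr2, div_self (pow_ne_zero 2 hrpos.ne')]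
    nlinarith [norm_nonneg v]
  refine ⟨⟨v, mem_sphere_zero_iff_norm.2 hv⟩, z, hzlt, ?_⟩
  apply Subtype.ext; apply Subtype.ext
  rw [coe_coe_boundaryTorusPt]
  change boundaryTorusVec _ z = u
  have hsq : Real.sqrt (1 - ‖z‖ ^ 2) = r := by rw [hz1]
  ext i
  fin_cases i
  · change Real.sqrt (1 - ‖z‖ ^ 2) * (u 0 / r) = u 0
    rw [hsq, mul_div_cancel₀ _ hrpos.ne']
  · change Real.sqrt (1 - ‖z‖ ^ 2) * (u 1 / r) = u 1
    rw [hsq, mul_div_cancel₀ _ hrpos.ne']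
  · rfl
  · rfl

namespace AchiralLefschetz

/-- **The page angle** `θᵢ = -(i + ½)/n` of the `i`-th of `n` letters: `e^{2πiθᵢ}` is
`LefschetzBase.pageDir n i = e^{-2πi(i+½)/n}` (`LefschetzBasePages.lean`): pages CLOCKWISE in the
letter index, all in the fundamental domain `(-1, 0)` (Akbulut–Ozbagci 2001, §2.3).
[cite: AkbulutOzbagci2001, §2.3] -/
def pageAngle (n i : ℕ) : ℝ := -((i : ℝ) + 1 / 2) / n

/-- The page angles of a word of length `n` lie in `(-1, 0)`. [folklore] -/
theorem pageAngle_mem_Ioo {n i : ℕ} (hi : i < n) : pageAngle n i ∈ Ioo (-1 : ℝ) 0 := by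
  have hn : (0 : ℝ) < n := by exact_mod_cast (Nat.zero_le i).trans_lt hi
  have hi' : (i : ℝ) + 1 ≤ n := by exact_mod_cast hi
  rw [pageAngle, mem_Ioo, neg_div, neg_lt_neg_iff, div_lt_one hn, neg_lt_zero,
    div_pos_iff_of_pos_right hn]
  constructor <;> linarith

/-- The page angles DECREASE strictly with the letter index (clockwise order). [folklore] -/
theorem pageAngle_strictAnti {n : ℕ} (hn : 0 < n) : StrictAnti (pageAngle n) := by
  intro i j hij
  have hn' : (0 : ℝ) < n := by exact_mod_cast hn
  have hij' : (i : ℝ) < j := by exact_mod_cast hij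
  rw [pageAngle, pageAngle, neg_div, neg_div, neg_lt_neg_iff]
  exact div_lt_div_of_pos_right (by linarith) hn'

/-- Distinct letters of a word get pages of distinct directions `e^{2πiθᵢ}`. [folklore] -/
theorem circlePt_pageAngle_injective (n : ℕ) :
    Injective fun i : Fin n => circlePt (pageAngle n i) := by
  intro i j hij
  have key : ∀ {a b : ℝ}, a ∈ Ioo (-1 : ℝ) 0 → b ∈ Ioo (-1 : ℝ) 0 → circlePt a = circlePt b →
      a ≤ b := by
    intro a b ha hb hab
    by_contra hlt
    rw [not_le] at hlt
    have h1 : angA (circlePt (a + 1)) = a + 1 :=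
      angA_circlePt ⟨by linarith [ha.1], by linarith [ha.2]⟩
    have h2 : angA (circlePt (b + 1)) = b + 1 :=
      angA_circlePt ⟨by linarith [hb.1], by linarith [hb.2]⟩
    rw [circlePt_add_one, hab, ← circlePt_add_one, h2] at h1
    linarith
  have hi := pageAngle_mem_Ioo i.2
  have hj := pageAngle_mem_Ioo j.2
  have heq : pageAngle n i = pageAngle n j := le_antisymm (key hi hj hij) (key hj hi hij.symm)
  exact Fin.ext ((pageAngle_strictAnti (Fin.pos i)).injective heq)

/-- **The twist coefficient** `x^{∓1}` of a letter of sign `pos` at the core angle `x ∈ 𝕊¹ ⊂ ℂ`: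
`x̄ = x⁻¹` for a positive letter, `x` for a negative one. [cite: EtnyreFuller2006, §2] -/
def twistCoeff (pos : Bool) (x : 𝕊 1) : ℂ :=
  if pos then conj (toC (x : 𝔼 2)) else toC (x : 𝔼 2)

/-- The twist coefficient is unimodular. [folklore] -/
theorem norm_twistCoeff (pos : Bool) (x : 𝕊 1) : ‖twistCoeff pos x‖ = 1 := by
  cases pos <;> simp [twistCoeff, norm_toC_sphere]

variable {P : Type v}

/-- **The Lefschetz attaching model of the letter `c` in the page of angle `θ₀`, width `δ`**: the
point of `M` prescribed for the boundary-torus point `(x, z)` of the handle,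
`J (c.annulus (x, δ Re ζ), θ₀ + δ Im ζ)` with `ζ = twistCoeff c.pos x · z = x^{∓1} z`.  The core
`z = 0` goes to the cycle `x ↦ J (c(x), θ₀)` in the page `θ₀`; the handle framing (`z ∈ ℝ₊`) goes to
the direction `x^{∓1}` in the normal frame (`∂ₛ` = page framing, `∂_θ`): framing `pf - 1` for a
positive, `pf + 1` for a negative letter (Etnyre–Fuller 2006, §2; Gompf–Stipsicz 1999, §8.2).
[cite: EtnyreFuller2006, §2] -/
def attachModel {M : Type u} (J : P × ℝ → M) (c : SignedCycle P) (θ₀ δ : ℝ) (x : 𝕊 1)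
    (z : ℂ) : M :=
  J (c.annulus (x, δ * (twistCoeff c.pos x * z).re), θ₀ + δ * (twistCoeff c.pos x * z).im)

/-- On the core `z = 0` the model is the cycle pushed into the page `θ₀`. [folklore] -/
@[simp] theorem attachModel_zero {M : Type u} (J : P × ℝ → M) (c : SignedCycle P) (θ₀ δ : ℝ)
    (x : 𝕊 1) : attachModel J c θ₀ δ x 0 = J (c.curve x, θ₀) := by
  simp [attachModel, SignedCycle.curve]

end AchiralLefschetz

variable {P : Type v}

/-! ### Lefschetz links, the handlebody `X(P; w)` and the closed model -/

section Handlebody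

open AchiralLefschetz

variable [TopologicalSpace P] [ChartedSpace (EuclideanHalfSpace 2) P] [IsManifold (𝓡∂ 2) ∞ P]

/-- **The Lefschetz link of the achiral word `w` over the page `(P, o)`** in the boundary `b` of the
4-manifold `B`, with page system `J` of the open book `ob` of `∂B`, width `δ` and attaching maps
`h`: every letter's annulus chart is a smooth embedding of the open annulus into `int P` (an annulus
neighbourhood of the cycle, as in `IsDehnTwist`) which is orientation preserving for `o` (read
through its `1`-periodic lift `(t, s) ↦ annulus (e^{2πit}, s)` to `𝔼 2` with the standard
orientation); `δ > 0`; and the `i`-th attaching map IS the Lefschetz model of the `i`-th letter in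
the page of angle `pageAngle n i = -(i + ½)/n` (pages clockwise in the order of the word) on the
boundary torus of Kosinski's tube: `h i (√(1-|z|²) x, z) = b.incl (attachModel J wᵢ θᵢ δ x z)` —
attaching circle `cᵢ` pushed into the `i`-th page, framing `pf - εᵢ`.  By `exists_boundaryTorusPt_eq`
this prescribes `h i` on the whole boundary part of the tube; disjointness of the handles is part
of `HandleAttachingMap.IsMultiAttachment`. [cite: EtnyreFuller2006, §2] -/
structure IsLefschetzLinkOver (o : SmoothOrientation (𝓡∂ 2) P) (w : List (SignedCycle P))
    {B : Type u} [TopologicalSpace B] [ChartedSpace (EuclideanHalfSpace 4) B]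
    (b : BoundaryData (𝓡∂ 4) B (𝓡 3)) (ob : Literature.Geometry.Symplectic.OpenBook b.carrier)
    (J : P × ℝ → b.carrier) (δ : ℝ) (h : Fin w.length → HandleAttachingMap 3 2 B) : Prop where
  /-- `J` trivialises the open book of `∂B` with page `int P` -/
  pageSystem : IsPageSystem ob J
  /-- the annulus charts are smooth embeddings of the open annulus `𝕊¹ × ℝ` … -/
  isSmoothEmbedding : ∀ i : Fin w.length,
    Manifold.IsSmoothEmbedding ((𝓡 1).prod 𝓘(ℝ, ℝ)) (𝓡∂ 2) ∞ (w.get i).annulus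
  /-- … with values in the interior of `P` … -/
  interior : ∀ (i : Fin w.length) (p : (𝕊 1) × ℝ), (w.get i).annulus p ∈ (𝓡∂ 2).interior P
  /-- … and orientation preserving for `o` -/
  orient : ∀ i : Fin w.length, IsOrientationPreserving (SmoothOrientation.euclidean 2) o
    (fun p : 𝔼 2 => (w.get i).annulus (circlePt (p 0), p 1))
  /-- the width of the attaching regions is positive -/
  delta_pos : 0 < δ
  /-- on the boundary torus the `i`-th attaching map is the Lefschetz model of the `i`-th letter in
  the `i`-th page -/
  apply_eq : ∀ (i : Fin w.length) (x : 𝕊 1) (z : ℂ) (hz : ‖z‖ < 1),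
    (h i).toFun (boundaryTorusPt x z hz) =
      b.incl (attachModel J (w.get i) (pageAngle w.length i) δ x z)

namespace IsLefschetzLinkOver

variable {o : SmoothOrientation (𝓡∂ 2) P} {w : List (SignedCycle P)}
  {B : Type u} [TopologicalSpace B] [ChartedSpace (EuclideanHalfSpace 4) B]
  {b : BoundaryData (𝓡∂ 4) B (𝓡 3)} {ob : Literature.Geometry.Symplectic.OpenBook b.carrier}
  {J : P × ℝ → b.carrier} {δ : ℝ} {h : Fin w.length → HandleAttachingMap 3 2 B}

/-- **The attaching circle of the `i`-th handle is the `i`-th cycle pushed into the `i`-th page**: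
`(h i).attachingCircle x = b.incl (J (cᵢ x, θᵢ))`. [cite: EtnyreFuller2006, §2] -/
theorem attachingCircle_eq (hl : IsLefschetzLinkOver o w b ob J δ h) (i : Fin w.length)
    (x : 𝕊 1) :
    (h i).attachingCircle x = b.incl (J ((w.get i).curve x, pageAngle w.length i)) := by
  rw [HandleAttachingMap.attachingCircle, ← boundaryTorusPt_zero, hl.apply_eq i x 0,
    attachModel_zero]

/-- The attaching circle of the `i`-th handle lies on (the image in `B` of) the `i`-th page.
[folklore] -/
theorem exists_mem_page_attachingCircle_eq (hl : IsLefschetzLinkOver o w b ob J δ h)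
    (i : Fin w.length) (x : 𝕊 1) :
    ∃ y ∈ ob.page (circlePt (pageAngle w.length i)), (h i).attachingCircle x = b.incl y :=
  ⟨J ((w.get i).curve x, pageAngle w.length i),
    hl.pageSystem.mem_page _ (hl.interior i (x, 0)) _, hl.attachingCircle_eq i x⟩

/-- The attaching circles of distinct handles lie on distinct pages, hence are disjoint (pages of
an open book over distinct points of the circle are disjoint). [folklore] -/
theorem attachingCircle_ne (hl : IsLefschetzLinkOver o w b ob J δ h) {i j : Fin w.length}
    (hij : i ≠ j) (x x' : 𝕊 1) : (h i).attachingCircle x ≠ (h j).attachingCircle x' := by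
  intro he
  rw [hl.attachingCircle_eq, hl.attachingCircle_eq] at he
  have he' := b.injective_incl he
  have hi := hl.pageSystem.proj_apply (hl.interior i (x, 0)) (pageAngle w.length i)
  have hj := hl.pageSystem.proj_apply (hl.interior j (x', 0)) (pageAngle w.length j)
  rw [SignedCycle.curve, SignedCycle.curve] at he'
  rw [he', hj] at hi
  exact hij (circlePt_pageAngle_injective w.length hi.symm)

/-- On the boundary part `T ∩ ∂D⁴` of Kosinski's tube the attaching maps of a Lefschetz link take
values in the image of the page system (every boundary point of the tube is a torus point,
`exists_boundaryTorusPt_eq`). [folklore] -/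
theorem exists_apply_eq_incl (hl : IsLefschetzLinkOver o w b ob J δ h) (i : Fin w.length)
    {y : ↥(handleTube 3 2)} (hy : ‖((y : 𝔻 4) : 𝔼 4)‖ = 1) :
    ∃ (x : 𝕊 1) (z : ℂ), ‖z‖ < 1 ∧
      (h i).toFun y = b.incl (attachModel J (w.get i) (pageAngle w.length i) δ x z) := by
  obtain ⟨x, z, hz, rfl⟩ := exists_boundaryTorusPt_eq hy
  exact ⟨x, z, hz, hl.apply_eq i x z hz⟩

end IsLefschetzLinkOver

variable (P) in
/-- **`W` is the achiral Lefschetz handlebody `X(P; w)`** of the word `w` over the oriented page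
`(P, o)` (Kas 1980; Gompf–Stipsicz 1999, §8.2; Etnyre–Fuller 2006, §2): there are a compact
connected orientable smooth 4-manifold with boundary `B` which is a 1-handlebody
(`IsHandlebodyOfIndexLE 3 1 B`; on paper `B ≅ P × D² ≅ ♮ᵏ S¹ × B³`), an open book on its boundary
with a page system `J` by `P` (so `∂B = ∂(P × D²)` as an open book), and a Lefschetz link of `w`
over it (`IsLefschetzLinkOver`), such that `W` is `B` with these `|w|` 2-handles attached
simultaneously (`HandleAttachingMap.IsMultiAttachment`).  Equivalently `W` is the total space of the
achiral Lefschetz fibration over `D²` with fibre `P` and Hurwitz word `w`. [cite: Kas1980] -/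
def IsLefschetzHandlebodyOver (o : SmoothOrientation (𝓡∂ 2) P) (w : List (SignedCycle P))
    (W : Type u) [TopologicalSpace W] [ChartedSpace (EuclideanHalfSpace 4) W] : Prop :=
  ∃ (B : Type u) (_ : TopologicalSpace B) (_ : T2Space B) (_ : SecondCountableTopology B)
    (_ : CompactSpace B) (_ : ConnectedSpace B) (_ : ChartedSpace (EuclideanHalfSpace 4) B)
    (_ : IsManifold (𝓡∂ 4) ∞ B) (b : BoundaryData (𝓡∂ 4) B (𝓡 3))
    (ob : Literature.Geometry.Symplectic.OpenBook b.carrier) (J : P × ℝ → b.carrier) (δ : ℝ)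
    (h : Fin w.length → HandleAttachingMap 3 2 B),
    IsHandlebodyOfIndexLE 3 1 B ∧ IsOrientable (𝓡∂ 4) B ∧ IsLefschetzLinkOver o w b ob J δ h ∧
      HandleAttachingMap.IsMultiAttachment h (𝓡∂ 4) W

variable (P) in
/-- **`X` is the closed achiral Lefschetz model `X̂(P; w)`** of the word `w` over the oriented page
`(P, o)`: `X = W ∪_Ψ V` (`IsBoundaryGluing`) for a compact achiral Lefschetz handlebody `W = X(P; w)`
(`IsLefschetzHandlebodyOver`), a compact connected orientable 1-handlebody `V` (`k` 3-handles and a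
4-handle turned upside down) and SOME diffeomorphism `Ψ : ∂W ≅ ∂V` — on which the result does not
depend (Laudenbach–Poénaru 1972; tree facts `exists_diffeomorph_comp_incl_eq`,
`nonempty_diffeomorph_of_isBoundaryGluing_twoHandlebody`).  For `w` an achiral factorisation of the
identity of `Mod(P, ∂P)` this is `X(P; w) ∪ (P × D²)`, the achiral Lefschetz fibration over `S²` with
fibre `P` and word `w` closed off (Gompf–Stipsicz 1999, §8.2; Etnyre–Fuller 2006, proof of Thm. 1);
see the module docstring, Faithfulness (3), for other words. [cite: GompfStipsiczGSM1999, §8.2] -/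
def IsAchiralLefschetzModel (o : SmoothOrientation (𝓡∂ 2) P) (w : List (SignedCycle P))
    (X : Type u) [TopologicalSpace X] [ChartedSpace (𝔼 4) X] : Prop :=
  ∃ (W : Type u) (_ : TopologicalSpace W) (_ : T2Space W) (_ : SecondCountableTopology W)
    (_ : CompactSpace W) (_ : ChartedSpace (EuclideanHalfSpace 4) W) (_ : IsManifold (𝓡∂ 4) ∞ W)
    (V : Type u) (_ : TopologicalSpace V) (_ : T2Space V) (_ : SecondCountableTopology V)
    (_ : CompactSpace V) (_ : ConnectedSpace V) (_ : ChartedSpace (EuclideanHalfSpace 4) V)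
    (_ : IsManifold (𝓡∂ 4) ∞ V)
    (bW : BoundaryData (𝓡∂ 4) W (𝓡 3)) (bV : BoundaryData (𝓡∂ 4) V (𝓡 3))
    (Ψ : bW.carrier ≃ₘ⟮𝓡 3, 𝓡 3⟯ bV.carrier),
    IsLefschetzHandlebodyOver P o w W ∧ IsHandlebodyOfIndexLE 3 1 V ∧ IsOrientable (𝓡∂ 4) V ∧
      IsBoundaryGluing bW bV Ψ (𝓡 4) X

/-! ### API -/

variable {o : SmoothOrientation (𝓡∂ 2) P} {w : List (SignedCycle P)}

/-- A closed achiral Lefschetz model exhibits `X` as a closed gluing of two compact pieces; in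
particular `X` is compact. [folklore] -/
theorem IsAchiralLefschetzModel.compactSpace {X : Type u} [TopologicalSpace X]
    [ChartedSpace (𝔼 4) X] (hX : IsAchiralLefschetzModel P o w X) : CompactSpace X := by
  obtain ⟨W, _, _, _, _, _, _, V, _, _, _, _, _, _, _, bW, bV, Ψ, -, -, -, hglue⟩ := hX
  exact hglue.compactSpace

/-- A closed achiral Lefschetz model is, forgetting the Lefschetz structure, a closed 4-manifold
glued from a compact piece and a compact connected orientable 1-handlebody along a boundary
diffeomorphism (the shape consumed by the Laudenbach–Poénaru facts). [folklore] -/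
theorem IsAchiralLefschetzModel.exists_isBoundaryGluing {X : Type u} [TopologicalSpace X]
    [ChartedSpace (𝔼 4) X] (hX : IsAchiralLefschetzModel P o w X) :
    ∃ (W : Type u) (_ : TopologicalSpace W) (_ : T2Space W) (_ : SecondCountableTopology W)
      (_ : CompactSpace W) (_ : ChartedSpace (EuclideanHalfSpace 4) W) (_ : IsManifold (𝓡∂ 4) ∞ W)
      (V : Type u) (_ : TopologicalSpace V) (_ : T2Space V) (_ : SecondCountableTopology V)
      (_ : CompactSpace V) (_ : ConnectedSpace V) (_ : ChartedSpace (EuclideanHalfSpace 4) V)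
      (_ : IsManifold (𝓡∂ 4) ∞ V)
      (bW : BoundaryData (𝓡∂ 4) W (𝓡 3)) (bV : BoundaryData (𝓡∂ 4) V (𝓡 3))
      (Ψ : bW.carrier ≃ₘ⟮𝓡 3, 𝓡 3⟯ bV.carrier),
      IsHandlebodyOfIndexLE 3 1 V ∧ IsOrientable (𝓡∂ 4) V ∧ IsBoundaryGluing bW bV Ψ (𝓡 4) X := by
  obtain ⟨W, _, _, _, _, _, _, V, _, _, _, _, _, _, _, bW, bV, Ψ, -, hV, hVo, hglue⟩ := hX
  exact ⟨W, ‹_›, ‹_›, ‹_›, ‹_›, ‹_›, ‹_›, V, ‹_›, ‹_›, ‹_›, ‹_›, ‹_›, ‹_›, ‹_›, bW, bV, Ψ, hV, hVo,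
    hglue⟩

/-- The handlebody underlying a closed model has as many 2-handles as the word has letters: the
Lefschetz link is indexed by `Fin w.length` (bookkeeping form of "one 2-handle per vanishing
cycle"). [folklore] -/
theorem IsLefschetzHandlebodyOver.exists_isMultiAttachment {W : Type u} [TopologicalSpace W]
    [ChartedSpace (EuclideanHalfSpace 4) W] (hW : IsLefschetzHandlebodyOver P o w W) :
    ∃ (B : Type u) (_ : TopologicalSpace B) (_ : T2Space B)
      (_ : ChartedSpace (EuclideanHalfSpace 4) B) (h : Fin w.length → HandleAttachingMap 3 2 B),
      IsHandlebodyOfIndexLE 3 1 B ∧ HandleAttachingMap.IsMultiAttachment h (𝓡∂ 4) W := by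
  obtain ⟨B, _, _, _, _, _, _, _, b, ob, J, δ, h, hB, -, -, hW⟩ := hW
  exact ⟨B, ‹_›, ‹_›, ‹_›, h, hB, hW⟩

end Handlebody

end Literature.Topology.FourManifolds

end
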